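import Literature.NumberTheory.Transcendental.PkappaThetaBlockRelations
import Literature.NumberTheory.Transcendental.ChudnovskyAnalytic
import Literature.NumberTheory.EllipticCurves.RealLatticePeriodHalfPeriodsProofs
import Mathlib.Topology.Algebra.MvPolynomial
import HarnessLib

/-!
# The Wronskians of the block theta functions `P_i`, `Z_i` are quadratic forms

Topic `Literature/NumberTheory/Transcendental`. A brick for the theta-model instance of the
abstract zero estimate (`ZeroEstModel.lean`, field `wronsk`): for the six entire functions
`U = (P₀, P₁, P₂, Z₀, Z₁, Z₂) = σ³ (1, ℘, ℘′, ζ, ℘ζ, ℘′ζ + 2℘²)` of ONE block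
(`PeriodPair.univExtP/Z`) and every pair `a, b`, the Wronskian `U_b U_a′ - U_a U_b′` is an
explicit quadratic form `blockWronsk a b` in `U` evaluated at `U(z)` (`wronskian_blockFn`), on
all of `ℂ`: `(σ³f)′ = σ³(3ζ f + f′)` makes the `ζ`-terms cancel,
`U_b U_a′ - U_a U_b′ = σ⁶ (f′_a f_b - f_a f′_b)`, and the fifteen derivatives `f′_a f_b - f_a f′_b`
are quadratic in `(1, ℘, ℘′, ζ, ℘ζ, ℘′ζ + 2℘²)` by `ζ′ = -℘`, `℘″ = 6℘² - g₂/2` and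
`℘′² = 4℘³ - g₂℘ - g₃` (the table in the module, checked by `linear_combination`); the lattice
points follow by continuity. Everything is PROVED.

## References

* E. T. Whittaker, G. N. Watson, *A Course of Modern Analysis*, 4th ed., CUP 1927, §20.2–20.53.
  [WhittakerWatson1927]
-/

noncomputable section

open MvPolynomial Complex Filter Topology
open scoped PeriodPair

namespace Literature.NumberTheory.Transcendental

variable (L : PeriodPair)

/-! ### The block family and its derivatives off the lattice -/

/-- The six block functions `U = (P₀, P₁, P₂, Z₀, Z₁, Z₂)`. [folklore] -/
def _root_.PeriodPair.blockFn : Fin 3 ⊕ Fin 3 → ℂ → ℂ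
  | Sum.inl i => L.univExtP i
  | Sum.inr i => L.univExtZ i

/-- The block functions are entire. [folklore] -/
theorem _root_.PeriodPair.differentiable_blockFn (a : Fin 3 ⊕ Fin 3) : Differentiable ℂ (L.blockFn a) := by
  rcases a with i | i
  · exact L.differentiable_univExtP i
  · exact L.differentiable_univExtZ i

/-- The derivatives of the block functions are continuous. [folklore] -/
theorem _root_.PeriodPair.continuous_deriv_blockFn (a : Fin 3 ⊕ Fin 3) : Continuous (deriv (L.blockFn a)) := by
  have h : AnalyticOnNhd ℂ (L.blockFn a) Set.univ :=
    (L.differentiable_blockFn a).differentiableOn.analyticOnNhd isOpen_univ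
  exact continuousOn_univ.mp h.deriv.continuousOn

/-- The affine factors `u = (1, ℘, ℘′, ζ, ℘ζ, ℘′ζ + 2℘²)` with `U = σ³ u` off the lattice. [folklore] -/
def _root_.PeriodPair.blockAff : Fin 3 ⊕ Fin 3 → ℂ → ℂ
  | Sum.inl 0 => fun _ => 1
  | Sum.inl 1 => ℘[L]
  | Sum.inl 2 => ℘'[L]
  | Sum.inr 0 => L.weierstrassZeta
  | Sum.inr 1 => fun z => ℘[L] z * L.weierstrassZeta z
  | Sum.inr 2 => fun z => ℘'[L] z * L.weierstrassZeta z + 2 * ℘[L] z ^ 2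

/-- The derivatives `u′` off the lattice: `(0, ℘′, 6℘² - g₂/2, -℘, ℘′ζ - ℘², (6℘² - g₂/2)ζ + 3℘℘′)`. [folklore] -/
def _root_.PeriodPair.blockAffDeriv : Fin 3 ⊕ Fin 3 → ℂ → ℂ
  | Sum.inl 0 => fun _ => 0
  | Sum.inl 1 => ℘'[L]
  | Sum.inl 2 => fun z => 6 * ℘[L] z ^ 2 - L.g₂ / 2
  | Sum.inr 0 => fun z => -℘[L] z
  | Sum.inr 1 => fun z => ℘'[L] z * L.weierstrassZeta z - ℘[L] z ^ 2
  | Sum.inr 2 => fun z => (6 * ℘[L] z ^ 2 - L.g₂ / 2) * L.weierstrassZeta z + 3 * ℘[L] z * ℘'[L] z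

/-- `U_a = σ³ u_a` off the lattice. [folklore] -/
theorem _root_.PeriodPair.blockFn_eq {z : ℂ} (hz : z ∉ L.lattice) (a : Fin 3 ⊕ Fin 3) :
    L.blockFn a z = L.weierstrassSigma z ^ 3 * L.blockAff a z := by
  obtain ⟨p0, p1, p2⟩ := PeriodPair.univExtP_eq (L := L) hz
  obtain ⟨z0, z1, z2⟩ := PeriodPair.univExtZ_eq (L := L) hz
  rcases a with i | i <;> fin_cases i <;>
    simp [PeriodPair.blockFn, PeriodPair.blockAff, p0, p1, p2, z0, z1, z2]

/-- `HasDerivAt u_a (u′_a z) z` off the lattice. [folklore] -/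
theorem _root_.PeriodPair.hasDerivAt_blockAff {z : ℂ} (hz : z ∉ L.lattice) (a : Fin 3 ⊕ Fin 3) :
    HasDerivAt (L.blockAff a) (L.blockAffDeriv a z) z := by
  have h℘ : HasDerivAt ℘[L] (℘'[L] z) z := by
    have hd : DifferentiableAt ℂ ℘[L] z :=
      L.differentiableOn_weierstrassP.differentiableAt (L.isClosed_lattice.isOpen_compl.mem_nhds hz)
    simpa using hd.hasDerivAt
  have h℘' : HasDerivAt ℘'[L] (6 * ℘[L] z ^ 2 - L.g₂ / 2) z := L.hasDerivAt_derivWeierstrassP hz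
  have hζ : HasDerivAt L.weierstrassZeta (-℘[L] z) z := PeriodPair.hasDerivAt_weierstrassZeta hz
  rcases a with i | i <;> fin_cases i
  · exact hasDerivAt_const z (1 : ℂ)
  · exact h℘
  · exact h℘'
  · exact hζ
  · show HasDerivAt (fun z => ℘[L] z * L.weierstrassZeta z) _ z
    exact (h℘.fun_mul hζ).congr_deriv (by simp only [PeriodPair.blockAffDeriv]; ring)
  · show HasDerivAt (fun z => ℘'[L] z * L.weierstrassZeta z + 2 * ℘[L] z ^ 2) _ z
    exact ((h℘'.fun_mul hζ).fun_add ((h℘.fun_pow 2).const_mul 2)).congr_deriv (by simp only [PeriodPair.blockAffDeriv]; ring)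

/-- **`U_a′ = σ³ (3ζ u_a + u′_a)` off the lattice** (`σ′ = σζ`). [cite: WhittakerWatson1927, §20.42] -/
theorem _root_.PeriodPair.deriv_blockFn {z : ℂ} (hz : z ∉ L.lattice) (a : Fin 3 ⊕ Fin 3) :
    deriv (L.blockFn a) z = L.weierstrassSigma z ^ 3 * (3 * L.weierstrassZeta z * L.blockAff a z + L.blockAffDeriv a z) := by
  -- `U_a = σ³ u_a` near `z`
  have hopen : IsOpen ((L.lattice : Set ℂ)ᶜ) := L.isClosed_lattice.isOpen_compl
  have heq : L.blockFn a =ᶠ[𝓝 z] fun w => L.weierstrassSigma w ^ 3 * L.blockAff a w := by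
    filter_upwards [hopen.mem_nhds hz] with w hw
    exact L.blockFn_eq hw a
  rw [heq.deriv_eq]
  have hσd : HasDerivAt L.weierstrassSigma (L.weierstrassZeta z * L.weierstrassSigma z) z := by
    have hd : DifferentiableAt ℂ L.weierstrassSigma z := (L.differentiable_sigmaDeriv 0) z |>.congr_of_eventuallyEq (by simp)
    rw [← Chudnovsky.deriv_weierstrassSigma L hz]
    exact hd.hasDerivAt
  have h := ((hσd.fun_pow 3).fun_mul (L.hasDerivAt_blockAff hz a))
  rw [h.deriv]
  push_cast
  ring

/-! ### The table of quadratic forms -/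

/-- A quadratic form given by a list of terms `(r, c, d) ↦ r · X_c X_d`. [folklore] -/
def quadOfTerms (l : List (ℂ × (Fin 3 ⊕ Fin 3) × (Fin 3 ⊕ Fin 3))) : MvPolynomial (Fin 3 ⊕ Fin 3) ℂ :=
  (l.map fun t => C t.1 * X t.2.1 * X t.2.2).sum

/-- `quadOfTerms l` is a quadratic form. [folklore] -/
theorem isHomogeneous_quadOfTerms (l : List (ℂ × (Fin 3 ⊕ Fin 3) × (Fin 3 ⊕ Fin 3))) : (quadOfTerms l).IsHomogeneous 2 := by
  induction l with
  | nil => exact isHomogeneous_zero _ _ _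
  | cons t l ih =>
    simp only [quadOfTerms, List.map_cons, List.sum_cons] at ih ⊢
    refine IsHomogeneous.add ?_ ih
    have := ((isHomogeneous_C (Fin 3 ⊕ Fin 3) t.1).mul (isHomogeneous_X ℂ t.2.1)).mul (isHomogeneous_X ℂ t.2.2)
    simpa using this

/-- Evaluation of `quadOfTerms`. [folklore] -/
theorem eval_quadOfTerms (u : Fin 3 ⊕ Fin 3 → ℂ) (l : List (ℂ × (Fin 3 ⊕ Fin 3) × (Fin 3 ⊕ Fin 3))) :
    eval u (quadOfTerms l) = (l.map fun t => t.1 * u t.2.1 * u t.2.2).sum := by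
  induction l with
  | nil => simp [quadOfTerms]
  | cons t l ih =>
    simp only [quadOfTerms, List.map_cons, List.sum_cons, map_add, map_mul, eval_C, eval_X] at ih ⊢
    rw [ih]

open Sum in
/-- The upper part of the table, as term lists: `blockTerms a b` represents `U_b U_a′ - U_a U_b′`
for the fifteen pairs `a > b` (order `P₀ < P₁ < P₂ < Z₀ < Z₁ < Z₂`), `[]` otherwise.
[folklore] -/
def _root_.PeriodPair.blockTerms : Fin 3 ⊕ Fin 3 → Fin 3 ⊕ Fin 3 → List (ℂ × (Fin 3 ⊕ Fin 3) × (Fin 3 ⊕ Fin 3))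
  | inl 1, inl 0 => [(1, inl 0, inl 2)]
  | inl 2, inl 0 => [(6, inl 1, inl 1), (-(L.g₂ / 2), inl 0, inl 0)]
  | inl 2, inl 1 => [(1 / 2, inl 2, inl 2), (L.g₂, inl 0, inl 1), (3 * L.g₃ / 2, inl 0, inl 0)]
  | inr 0, inl 0 => [(-1, inl 0, inl 1)]
  | inr 0, inl 1 => [(-1, inl 1, inl 1), (-1, inr 0, inl 2)]
  | inr 0, inl 2 => [(-1, inl 1, inl 2), (-6, inr 1, inl 1), (L.g₂ / 2, inr 0, inl 0)]
  | inr 1, inl 0 => [(1, inr 2, inl 0), (-3, inl 1, inl 1)]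
  | inr 1, inl 1 => [(-(1 / 4), inl 2, inl 2), (-(L.g₂ / 4), inl 0, inl 1), (-(L.g₃ / 4), inl 0, inl 0)]
  | inr 1, inl 2 => [(-(1 / 2), inr 2, inl 2), (-L.g₂, inr 1, inl 0), (-(3 * L.g₃ / 2), inr 0, inl 0)]
  | inr 2, inl 0 => [(6, inl 1, inr 1), (-(L.g₂ / 2), inr 0, inl 0), (3, inl 1, inl 2)]
  | inr 2, inl 1 => [(1 / 2, inr 2, inl 2), (L.g₂, inr 1, inl 0), (3 * L.g₃ / 2, inr 0, inl 0)]
  | inr 2, inl 2 => [(-(2 * L.g₂), inl 1, inl 1), (-(3 * L.g₃), inl 1, inl 0)]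
  | inr 1, inr 0 => [(1, inr 0, inr 2), (-2, inl 1, inr 1)]
  | inr 2, inr 0 => [(6, inr 1, inr 1), (-(L.g₂ / 2), inr 0, inr 0), (4, inl 1, inr 2), (-(3 / 2), inl 2, inl 2),
      (-(3 * L.g₂ / 2), inl 1, inl 0), (-(3 * L.g₃ / 2), inl 0, inl 0)]
  | inr 2, inr 1 => [(1 / 2, inr 2, inr 2), (L.g₂, inr 0, inr 1), (3 * L.g₃ / 2, inr 0, inr 0)]
  | _, _ => []

/-- **The quadratic Wronskian forms of one block**: `blockWronsk a b = W₀ a b - W₀ b a`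
(antisymmetric, zero on the diagonal). [folklore] -/
def _root_.PeriodPair.blockWronsk (a b : Fin 3 ⊕ Fin 3) : MvPolynomial (Fin 3 ⊕ Fin 3) ℂ :=
  quadOfTerms (L.blockTerms a b) - quadOfTerms (L.blockTerms b a)

/-- `blockWronsk` is antisymmetric. [folklore] -/
theorem _root_.PeriodPair.blockWronsk_swap (a b : Fin 3 ⊕ Fin 3) : L.blockWronsk b a = -L.blockWronsk a b := by
  simp [PeriodPair.blockWronsk]

/-- **`blockWronsk a b` is a quadratic form.** [folklore] -/
theorem _root_.PeriodPair.isHomogeneous_blockWronsk (a b : Fin 3 ⊕ Fin 3) : (L.blockWronsk a b).IsHomogeneous 2 :=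
  (isHomogeneous_quadOfTerms _).sub (isHomogeneous_quadOfTerms _)

/-! ### The formal identity behind the table -/

open Sum in
/-- Symbolic values of `u` at `(℘, ℘′, ζ) = (p, q, r)`. [folklore] -/
def affVal (p q r : ℂ) : Fin 3 ⊕ Fin 3 → ℂ
  | inl 0 => 1
  | inl 1 => p
  | inl 2 => q
  | inr 0 => r
  | inr 1 => p * r
  | inr 2 => q * r + 2 * p ^ 2

open Sum in
/-- Symbolic values of `u′` at `(℘, ℘′, ζ) = (p, q, r)` (using `℘″ = 6℘² - g₂/2`, `ζ′ = -℘`). [folklore] -/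
def affDerivVal (p q r : ℂ) : Fin 3 ⊕ Fin 3 → ℂ
  | inl 0 => 0
  | inl 1 => q
  | inl 2 => 6 * p ^ 2 - L.g₂ / 2
  | inr 0 => -p
  | inr 1 => q * r - p ^ 2
  | inr 2 => (6 * p ^ 2 - L.g₂ / 2) * r + 3 * p * q

open Sum in
/-- The multiple of the Weierstrass relation `q² - (4p³ - g₂ p - g₃)` hidden in each entry. [folklore] -/
def kapVal (p r : ℂ) : Fin 3 ⊕ Fin 3 → Fin 3 ⊕ Fin 3 → ℂ
  | inl 2, inl 1 => -(3 / 2)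
  | inr 1, inl 1 => 1 / 4
  | inr 1, inl 2 => 3 / 2 * r
  | inr 2, inl 1 => -(3 / 2) * r
  | inr 2, inl 2 => 3 * p
  | inr 2, inr 0 => 3 / 2
  | inr 2, inr 1 => -(3 / 2) * r ^ 2
  | _, _ => 0

/-- **The formal identity**: `u′_a u_b - u_a u′_b - (W₀ a b - W₀ b a)(u) = (κ_{ab} - κ_{ba}) (q² - 4p³ + g₂p + g₃)`
identically in `p, q, r`. [folklore] -/
theorem wronsk_formal (p q r : ℂ) (a b : Fin 3 ⊕ Fin 3) :
    affDerivVal L p q r a * affVal p q r b - affVal p q r a * affDerivVal L p q r b -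
      (((L.blockTerms a b).map fun t => t.1 * affVal p q r t.2.1 * affVal p q r t.2.2).sum -
        ((L.blockTerms b a).map fun t => t.1 * affVal p q r t.2.1 * affVal p q r t.2.2).sum) =
      (kapVal p r a b - kapVal p r b a) * (q ^ 2 - (4 * p ^ 3 - L.g₂ * p - L.g₃)) := by
  rcases a with i | i <;> rcases b with j | j <;> fin_cases i <;> fin_cases j <;>
    simp [affVal, affDerivVal, kapVal, PeriodPair.blockTerms] <;> ring

/-- `u_a(z) = affVal (℘ z) (℘′ z) (ζ z) a`. [folklore] -/
theorem _root_.PeriodPair.blockAff_eq_affVal (a : Fin 3 ⊕ Fin 3) (z : ℂ) :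
    L.blockAff a z = affVal (℘[L] z) (℘'[L] z) (L.weierstrassZeta z) a := by
  rcases a with i | i <;> fin_cases i <;> simp [PeriodPair.blockAff, affVal]

/-- `u′_a(z) = affDerivVal (℘ z) (℘′ z) (ζ z) a`. [folklore] -/
theorem _root_.PeriodPair.blockAffDeriv_eq_affDerivVal (a : Fin 3 ⊕ Fin 3) (z : ℂ) :
    L.blockAffDeriv a z = affDerivVal L (℘[L] z) (℘'[L] z) (L.weierstrassZeta z) a := by
  rcases a with i | i <;> fin_cases i <;> simp [PeriodPair.blockAffDeriv, affDerivVal]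

/-! ### The Wronskian identity -/

/-- The Wronskian identity off the lattice. [folklore] -/
theorem _root_.PeriodPair.wronskian_blockFn_of_notMem {z : ℂ} (hz : z ∉ L.lattice) (a b : Fin 3 ⊕ Fin 3) :
    L.blockFn b z * deriv (L.blockFn a) z - L.blockFn a z * deriv (L.blockFn b) z =
      eval (fun c => L.blockFn c z) (L.blockWronsk a b) := by
  have hode : ℘'[L] z ^ 2 - (4 * ℘[L] z ^ 3 - L.g₂ * ℘[L] z - L.g₃) = 0 := by
    rw [L.derivWeierstrassP_sq z hz]; ring
  have hf := wronsk_formal L (℘[L] z) (℘'[L] z) (L.weierstrassZeta z) a b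
  rw [hode, mul_zero, sub_eq_zero] at hf
  rw [L.deriv_blockFn hz a, L.deriv_blockFn hz b, L.blockFn_eq hz a, L.blockFn_eq hz b, PeriodPair.blockWronsk,
    map_sub, eval_quadOfTerms, eval_quadOfTerms]
  simp only [L.blockFn_eq hz, L.blockAff_eq_affVal, L.blockAffDeriv_eq_affDerivVal] at hf ⊢
  -- scale the formal identity by `σ⁶`
  set σ3 := L.weierstrassSigma z ^ 3 with hσ3
  have hscale : ∀ l : List (ℂ × (Fin 3 ⊕ Fin 3) × (Fin 3 ⊕ Fin 3)),
      (l.map fun t => t.1 * (σ3 * affVal (℘[L] z) (℘'[L] z) (L.weierstrassZeta z) t.2.1) *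
        (σ3 * affVal (℘[L] z) (℘'[L] z) (L.weierstrassZeta z) t.2.2)).sum =
      σ3 ^ 2 * (l.map fun t => t.1 * affVal (℘[L] z) (℘'[L] z) (L.weierstrassZeta z) t.2.1 *
        affVal (℘[L] z) (℘'[L] z) (L.weierstrassZeta z) t.2.2).sum := by
    intro l
    induction l with
    | nil => simp
    | cons t l ih => simp only [List.map_cons, List.sum_cons, ih]; ring
  rw [hscale, hscale]
  linear_combination σ3 ^ 2 * hf

/-- **The Wronskians of the block functions are the quadratic forms `blockWronsk`**, on all of `ℂ`:
`U_b(z) U_a′(z) - U_a(z) U_b′(z) = blockWronsk a b (U(z))`. [folklore] -/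
theorem _root_.PeriodPair.wronskian_blockFn (a b : Fin 3 ⊕ Fin 3) (z : ℂ) :
    L.blockFn b z * deriv (L.blockFn a) z - L.blockFn a z * deriv (L.blockFn b) z =
      eval (fun c => L.blockFn c z) (L.blockWronsk a b) := by
  have hc : ∀ c, Continuous (L.blockFn c) := fun c => (L.differentiable_blockFn c).continuous
  have hd : ∀ c, Continuous (deriv (L.blockFn c)) := fun c => L.continuous_deriv_blockFn c
  have key : (fun z => L.blockFn b z * deriv (L.blockFn a) z - L.blockFn a z * deriv (L.blockFn b) z) =
      fun z => eval (fun c => L.blockFn c z) (L.blockWronsk a b) := by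
    refine L.eq_of_eqOn_compl_lattice (((hc b).mul (hd a)).sub ((hc a).mul (hd b))) ?_
      fun w hw => L.wronskian_blockFn_of_notMem hw a b
    exact (MvPolynomial.continuous_eval (L.blockWronsk a b)).comp (continuous_pi fun c => hc c)
  exact congr_fun key z

end Literature.NumberTheory.Transcendental
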